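import Mathlib
import HarnessLib
import Summits.AtomisticToContinuum.FouriersLaw.Theses.JunctionLocality
import Summits.AtomisticToContinuum.FouriersLaw.Theorems.JunctionLocalityConductanceLowerBoundStubRowSum
import Summits.AtomisticToContinuum.FouriersLaw.Theorems.JunctionLocalityConductanceLowerBoundStubFisherSquare
import Summits.AtomisticToContinuum.FouriersLaw.Theorems.JunctionLocalitySuperadditiveResistanceKuboLimit

/-!
# Coupling transfer of the far-contact Dirichlet energy (helper `helper_couplingTransfer_farGradient` of line `far-contact-fisher-square`, crux stmt-AtomisticToContinuum-11749)

Pinned anharmonic chain, `T > 0`, `L ≥ 2`; `g_γ` = the LEFT bath's classical forward field at coupling `γ`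
(`(X_H + γS) g_γ = −(p_0² − T)`, mean zero, `C² ∩ L²(μ_T)`; `μ_T` does not depend on `γ`),
`v_γ = ∂_{p_{L−1}} g_γ`, `E(γ) = ‖v_γ‖²`. CLAIM: `γ₂² E(γ₂) ≤ γ₁² E(γ₁)` and `γ₁⁴ E(γ₁) ≤ γ₂⁴ E(γ₂)` for
`0 < γ₁ ≤ γ₂`. PROOF. (a) `polar_two` — `Kubo.polar` for two `σ`-pairs with DIFFERENT frictions
(`Kubo.polar_level` at cutoff level for the `c₁`-pairs `(f, k_f)`, `(h, k_h + (c₂ − c₁) S h)`, the extra term by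
`Kubo.integral_chi_mul_bathOp`, cutoff removed by dominated convergence):
`A₁ + A₂ = (γ₁ + γ₂) T (⟨∂_{p_0} g₁, ∂_{p_0} g₂⟩ + ⟨v₁, v₂⟩)`, `A_i = ⟨g_i, p_0² − T⟩`. (b) `field_facts` —
conservation `γ_i (g_i + g_i ∘ R) = H − ⟨H⟩` (as inside `stub_fisherSquare`: the `L²(μ_T)`-Liouville theorem),
hence `γ_i (v_i + (∂_{p_0} g_i) ∘ R) = p_{L−1}`; with `stub_rowSum`, `stub_fisherSquare` and Gaussian integration
by parts, `⟨p_{L−1}, v_i⟩ = 2γ_i E_i` and `γ_i A_i = T² − 2γ_i² T E_i`. (c) Substituting, the `T²` terms cancel: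
`⟨v₁, v₂⟩ γ₁γ₂(γ₁ + γ₂) = γ₁³ E₁ + γ₂³ E₂`; Cauchy–Schwarz then gives `(γ₁² x − γ₂² y)(γ₁ x − γ₂ y) ≤ 0`
(`x = √E₁`, `y = √E₂`), whence both inequalities (`couplingTransfer_real`).
References: Eckmann–Pillet–Rey-Bellet 1999 §3; Bonetto–Lebowitz–Rey-Bellet 2000 §5; folklore.
-/

noncomputable section

open MeasureTheory Filter Topology
open scoped ContDiff
open Literature.MathematicalPhysics.KineticTheory.HeatConduction
open Summit.AtomisticToContinuum.FouriersLaw.Theorems.SuperadditiveResistance.DeviceLiouville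
  (kin kin_eq_sq continuous_kin liouvilleOp bathOp generator_eq_liouvilleOp_add eq_zero_of_liouville_pinnedChain)
open Summit.AtomisticToContinuum.FouriersLaw.Theorems.SuperadditiveResistance.Kubo
  (memLp_partialP chi contDiff_chi hasCompactSupport_chi tendsto_integral_chi_mul tendsto_integral_partialP_chi_mul
    integrable_mul_mul_gibbsDensity continuous_source continuous_bathOp polar_level integral_chi_mul_bathOp
    tendsto_sum_mul)
open Summit.AtomisticToContinuum.FouriersLaw.Cruxes.SuperadditiveResistance.FloatingProbeBypassLaplacian
  (pinnedChain_memLp_two_snd pinnedChain_memLp_two_snd_sq pinnedChain_integral_snd_sq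
    integral_mul_sq_sub_gibbsMeasure generator_sub_const partialP_sub_const' liouvilleOp_add'
    liouvilleOp_const_mul bathOp_add' bathOp_const_mul)

namespace Summit.AtomisticToContinuum.FouriersLaw.Cruxes.ConductanceLowerBound.ForecastSensitivity

/-! ## (d) The real-algebra step -/

/-- From `V γ₁γ₂(γ₁+γ₂) = γ₁³E₁ + γ₂³E₂` and the Cauchy–Schwarz family `2tV ≤ E₁ + t²E₂` (`t ∈ ℝ`):
`γ₂²E₂ ≤ γ₁²E₁` and `γ₁⁴E₁ ≤ γ₂⁴E₂` whenever `0 < γ₁ ≤ γ₂`, `E₁, E₂ ≥ 0`. [folklore] -/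
theorem couplingTransfer_real {γ₁ γ₂ E₁ E₂ V : ℝ} (hγ₁ : 0 < γ₁) (h12 : γ₁ ≤ γ₂) (hE₁ : 0 ≤ E₁)
    (hE₂ : 0 ≤ E₂) (hV : V * (γ₁ * γ₂ * (γ₁ + γ₂)) = γ₁ ^ 3 * E₁ + γ₂ ^ 3 * E₂)
    (hCS : ∀ t : ℝ, 2 * t * V ≤ E₁ + t ^ 2 * E₂) :
    γ₂ ^ 2 * E₂ ≤ γ₁ ^ 2 * E₁ ∧ γ₁ ^ 4 * E₁ ≤ γ₂ ^ 4 * E₂ := by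
  have hγ₂ : 0 < γ₂ := hγ₁.trans_le h12
  obtain ⟨x, hx0, rfl⟩ : ∃ x, 0 ≤ x ∧ E₁ = x ^ 2 := ⟨Real.sqrt E₁, Real.sqrt_nonneg _, (Real.sq_sqrt hE₁).symm⟩
  obtain ⟨y, hy0, rfl⟩ : ∃ y, 0 ≤ y ∧ E₂ = y ^ 2 := ⟨Real.sqrt E₂, Real.sqrt_nonneg _, (Real.sq_sqrt hE₂).symm⟩
  have hVxy : V ≤ x * y := by
    refine not_lt.mp fun hlt => ?_
    have hV0 : 0 < V := (mul_nonneg hx0 hy0).trans_lt hlt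
    rcases hy0.eq_or_lt with hy | hy
    · subst hy
      have e : 2 * ((x ^ 2 + 1) / V) * V = 2 * (x ^ 2 + 1) := by field_simp
      nlinarith [hCS ((x ^ 2 + 1) / V)]
    · have hy2 : 0 < y ^ 2 := by positivity
      have h := mul_le_mul_of_nonneg_right (hCS (V / y ^ 2)) hy2.le
      have e2 : 2 * (V / y ^ 2) * V * y ^ 2 = 2 * V ^ 2 := by field_simp
      have e3 : (x ^ 2 + (V / y ^ 2) ^ 2 * y ^ 2) * y ^ 2 = (x * y) ^ 2 + V ^ 2 := by field_simp
      rw [e2, e3] at h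
      have h2 : V ^ 2 ≤ (x * y) ^ 2 := by linarith
      exact absurd ((pow_le_pow_iff_left₀ hV0.le (mul_nonneg hx0 hy0) two_ne_zero).mp h2) (not_le.mpr hlt)
  have hprod : (γ₁ ^ 2 * x - γ₂ ^ 2 * y) * (γ₁ * x - γ₂ * y) ≤ 0 := by
    have h1 : γ₁ ^ 3 * x ^ 2 + γ₂ ^ 3 * y ^ 2 ≤ x * y * (γ₁ * γ₂ * (γ₁ + γ₂)) := by
      rw [← hV]; exact mul_le_mul_of_nonneg_right hVxy (by positivity)
    nlinarith [h1]
  have hble : γ₁ ^ 2 * x - γ₂ ^ 2 * y ≤ γ₁ * (γ₁ * x - γ₂ * y) := by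
    nlinarith [mul_nonneg (mul_nonneg hγ₂.le hy0) (sub_nonneg.mpr h12)]
  have ha : 0 ≤ γ₁ * x - γ₂ * y := not_lt.mp fun hlt => by
    nlinarith [mul_pos_of_neg_of_neg (by nlinarith : γ₁ ^ 2 * x - γ₂ ^ 2 * y < 0) hlt]
  have hb : γ₁ ^ 2 * x - γ₂ ^ 2 * y ≤ 0 := by
    rcases ha.eq_or_lt with ha0 | hapos
    · nlinarith [hble]
    · exact not_lt.mp fun hlt => by nlinarith [mul_pos hlt hapos]
  have s1 := mul_self_le_mul_self (by positivity : 0 ≤ γ₂ * y) (by linarith : γ₂ * y ≤ γ₁ * x)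
  have s2 := mul_self_le_mul_self (by positivity : 0 ≤ γ₁ ^ 2 * x) (by linarith : γ₁ ^ 2 * x ≤ γ₂ ^ 2 * y)
  constructor <;> nlinarith [s1, s2]

/-! ## (a) The same-direction cross identity with two frictions -/

section Cross

variable {ω₂ lam β γ : ℝ} {L : ℕ}

/-- **Polarised Green identity with two frictions.** Pinned chain (`ω₂ > 0`, `lam, β ≥ 0`), `T > 0`, `B ≥ 0`,
a `σ`-pair `(f, k_f)` of friction `c₁ > 0` and a `σ`-pair `(h, k_h)` of friction `c₂ > 0` (`σ X_H u + c S_B u = −k_u`),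
`f, h ∈ C² ∩ L²(μ_T)`, `k_f, k_h ∈ L²(μ_T)`: `∫ h k_f ρ + ∫ f k_h ρ = (c₁ + c₂) T Σ_i B_i ∫ ∂_{p_i}f ∂_{p_i}h ρ`. [folklore] -/
theorem polar_two (hω : 0 < ω₂) (hl : 0 ≤ lam) (hβ : 0 ≤ β) (L : ℕ) {T : ℝ} (hT : 0 < T)
    (B : Fin L → ℝ) (hB : ∀ i, 0 ≤ B i) (σ : ℝ) {c₁ c₂ : ℝ} (hc₁ : 0 < c₁) (hc₂ : 0 < c₂)
    {f kf h kh : PhaseSpace L → ℝ} (hf : ContDiff ℝ 2 f) (hh : ContDiff ℝ 2 h)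
    (hf2 : MemLp f 2 ((pinnedChain ω₂ lam β γ).gibbsMeasure L T))
    (hh2 : MemLp h 2 ((pinnedChain ω₂ lam β γ).gibbsMeasure L T))
    (hkf2 : MemLp kf 2 ((pinnedChain ω₂ lam β γ).gibbsMeasure L T))
    (hkh2 : MemLp kh 2 ((pinnedChain ω₂ lam β γ).gibbsMeasure L T))
    (hpf : ∀ x, σ * liouvilleOp (pinnedChain ω₂ lam β γ) L f x + c₁ * bathOp L B T f x = -kf x)
    (hph : ∀ x, σ * liouvilleOp (pinnedChain ω₂ lam β γ) L h x + c₂ * bathOp L B T h x = -kh x) :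
    (∫ x, h x * kf x * (pinnedChain ω₂ lam β γ).gibbsDensity L T x) +
        ∫ x, f x * kh x * (pinnedChain ω₂ lam β γ).gibbsDensity L T x = (c₁ + c₂) * T *
      ∑ i, B i * ∫ x, partialP i f x * partialP i h x * (pinnedChain ω₂ lam β γ).gibbsDensity L T x := by
  set P := pinnedChain ω₂ lam β γ with hPdef
  set ρ : PhaseSpace L → ℝ := P.gibbsDensity L T with hρdef
  obtain ⟨hf1, hh1⟩ : ContDiff ℝ 1 f ∧ ContDiff ℝ 1 h := ⟨hf.of_le (by norm_cast), hh.of_le (by norm_cast)⟩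
  obtain ⟨hfc, hhc⟩ : Continuous f ∧ Continuous h := ⟨hf.continuous, hh.continuous⟩
  have hdfc : ∀ j, Continuous (partialP j f) := fun j => continuous_partialP hf1 one_ne_zero j
  have hdhc : ∀ j, Continuous (partialP j h) := fun j => continuous_partialP hh1 one_ne_zero j
  obtain ⟨hkfc, hkhc⟩ : Continuous kf ∧ Continuous kh :=
    ⟨continuous_source B T σ c₁ hf hpf, continuous_source B T σ c₂ hh hph⟩
  have hShc : Continuous (bathOp L B T h) := continuous_bathOp L B T hh
  have hρc : Continuous ρ := pinnedChain_continuous_gibbsDensity ω₂ lam β γ L T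
  have hHs : ContDiff ℝ ∞ (P.hamiltonian L) :=
    P.contDiff_hamiltonian (pinnedChain_contDiff_U ω₂ lam β γ) (pinnedChain_contDiff_V ω₂ lam β γ) L
  have hdf2 : ∀ i, 0 < B i → MemLp (partialP i f) 2 (P.gibbsMeasure L T) := fun i hi =>
    memLp_partialP hω hl hβ γ L hT B hB σ hc₁ hf hf2 hkf2 hpf hi
  have hdh2 : ∀ i, 0 < B i → MemLp (partialP i h) 2 (P.gibbsMeasure L T) := fun i hi =>
    memLp_partialP hω hl hβ γ L hT B hB σ hc₂ hh hh2 hkh2 hph hi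
  have hI1 : Integrable fun x => h x * kf x * ρ x := integrable_mul_mul_gibbsDensity hω hl hβ γ L hT hh2 hkf2
  have hI2 : Integrable fun x => f x * kh x * ρ x := integrable_mul_mul_gibbsDensity hω hl hβ γ L hT hf2 hkh2
  have hI_lhs : Integrable fun x => (h x * kf x + f x * kh x) * ρ x :=
    (hI1.add hI2).congr (ae_of_all _ fun x => by simp only [Pi.add_apply]; ring)
  have hI_dd : ∀ i, 0 < B i → Integrable fun x => partialP i f x * partialP i h x * ρ x :=
    fun i hi => integrable_mul_mul_gibbsDensity hω hl hβ γ L hT (hdf2 i hi) (hdh2 i hi)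
  have hI_err : ∀ i, 0 < B i → Integrable fun x => (h x * partialP i f x + f x * partialP i h x) * ρ x := fun i hi =>
    ((integrable_mul_mul_gibbsDensity hω hl hβ γ L hT hh2 (hdf2 i hi)).add
      (integrable_mul_mul_gibbsDensity hω hl hβ γ L hT hf2 (hdh2 i hi))).congr
      (ae_of_all _ fun x => by simp only [Pi.add_apply]; ring)
  have hI_fdh : ∀ i, 0 < B i → Integrable fun x => f x * partialP i h x * ρ x :=
    fun i hi => integrable_mul_mul_gibbsDensity hω hl hβ γ L hT hf2 (hdh2 i hi)
  have hph' : ∀ x, σ * liouvilleOp P L h x + c₁ * bathOp L B T h x = -(kh x + (c₂ - c₁) * bathOp L B T h x) := by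
    intro x; have := hph x; linarith
  have hlevel : ∀ n : ℕ, ∫ x, chi P L n x * (h x * kf x + f x * kh x) * ρ x =
      c₁ * T * ∑ i, B i * (2 * (∫ x, chi P L n x * (partialP i f x * partialP i h x) * ρ x) +
        ∫ x, partialP i (chi P L n) x * (h x * partialP i f x + f x * partialP i h x) * ρ x) +
      (c₂ - c₁) * T * ∑ i, B i * ((∫ x, chi P L n x * (partialP i f x * partialP i h x) * ρ x) +
        ∫ x, partialP i (chi P L n) x * (f x * partialP i h x) * ρ x) := by
    intro n
    have hP := polar_level hω hl hβ L hT B σ c₁ hf hh hpf hph' n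
    have hS := integral_chi_mul_bathOp hω hl hβ γ L B hT.ne' hf hh n
    rw [← hPdef] at hP hS
    rw [← hρdef] at hP hS
    have hχcont : Continuous (chi P L n) := (contDiff_chi hHs n).continuous
    have hχc : HasCompactSupport (chi P L n) := hasCompactSupport_chi hω hl hβ γ L n
    have i1 : Integrable fun x => chi P L n x * (h x * kf x + f x * kh x) * ρ x :=
      Continuous.integrable_of_hasCompactSupport (by fun_prop) hχc.mul_right.mul_right
    have i2 : Integrable fun x => chi P L n x * f x * bathOp L B T h x * ρ x :=
      Continuous.integrable_of_hasCompactSupport (by fun_prop) hχc.mul_right.mul_right.mul_right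
    have hsplit : ∫ x, chi P L n x * (h x * kf x + f x * (kh x + (c₂ - c₁) * bathOp L B T h x)) * ρ x =
        (∫ x, chi P L n x * (h x * kf x + f x * kh x) * ρ x) +
          (c₂ - c₁) * ∫ x, chi P L n x * f x * bathOp L B T h x * ρ x := by
      rw [← integral_const_mul, ← integral_add i1 (i2.const_mul _)]
      exact integral_congr_ae (ae_of_all _ fun x => by ring)
    have eI : ∀ i, ∫ x, chi P L n x * partialP i f x * partialP i h x * ρ x =
        ∫ x, chi P L n x * (partialP i f x * partialP i h x) * ρ x := fun i => integral_congr_ae (ae_of_all _ fun x => by ring)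
    have eW : ∀ i, ∫ x, (h x * partialP i f x + f x * partialP i h x) * partialP i (chi P L n) x * ρ x =
        ∫ x, partialP i (chi P L n) x * (h x * partialP i f x + f x * partialP i h x) * ρ x :=
      fun i => integral_congr_ae (ae_of_all _ fun x => by ring)
    have eV : ∀ i, ∫ x, f x * partialP i (chi P L n) x * partialP i h x * ρ x =
        ∫ x, partialP i (chi P L n) x * (f x * partialP i h x) * ρ x := fun i => integral_congr_ae (ae_of_all _ fun x => by ring)
    simp only [eI, eW] at hP
    simp only [eI, eV] at hS
    linear_combination hP - hsplit - (c₂ - c₁) * hS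
  have hlim_lhs : Tendsto (fun n : ℕ => ∫ x, chi P L n x * (h x * kf x + f x * kh x) * ρ x) atTop
      (𝓝 (∫ x, (h x * kf x + f x * kh x) * ρ x)) := tendsto_integral_chi_mul hω.le hl hβ γ L T (by fun_prop) hI_lhs
  have hlim_rhs : Tendsto (fun n : ℕ =>
      c₁ * T * ∑ i, B i * (2 * (∫ x, chi P L n x * (partialP i f x * partialP i h x) * ρ x) +
        ∫ x, partialP i (chi P L n) x * (h x * partialP i f x + f x * partialP i h x) * ρ x) +
      (c₂ - c₁) * T * ∑ i, B i * ((∫ x, chi P L n x * (partialP i f x * partialP i h x) * ρ x) +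
        ∫ x, partialP i (chi P L n) x * (f x * partialP i h x) * ρ x)) atTop
      (𝓝 (c₁ * T * ∑ i, B i * (2 * (∫ x, partialP i f x * partialP i h x * ρ x) + 0) +
        (c₂ - c₁) * T * ∑ i, B i * ((∫ x, partialP i f x * partialP i h x * ρ x) + 0))) := by
    refine ((tendsto_sum_mul B _ _ fun i hBi => ?_).const_mul (c₁ * T)).add
      ((tendsto_sum_mul B _ _ fun i hBi => ?_).const_mul ((c₂ - c₁) * T))
    · have hi : 0 < B i := lt_of_le_of_ne (hB i) (Ne.symm hBi)
      exact ((tendsto_integral_chi_mul hω.le hl hβ γ L T (by fun_prop) (hI_dd i hi)).const_mul 2).add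
        (tendsto_integral_partialP_chi_mul hω hl hβ γ L T i (by fun_prop) (hI_err i hi))
    · have hi : 0 < B i := lt_of_le_of_ne (hB i) (Ne.symm hBi)
      exact (tendsto_integral_chi_mul hω.le hl hβ γ L T (by fun_prop) (hI_dd i hi)).add
        (tendsto_integral_partialP_chi_mul hω hl hβ γ L T i (by fun_prop) (hI_fdh i hi))
  have heq := tendsto_nhds_unique hlim_lhs (hlim_rhs.congr fun n => (hlevel n).symm)
  have hsum : ∫ x, (h x * kf x + f x * kh x) * ρ x = (∫ x, h x * kf x * ρ x) + ∫ x, f x * kh x * ρ x := by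
    rw [← integral_add hI1 hI2]
    exact integral_congr_ae (ae_of_all _ fun x => by ring)
  rw [← hsum, heq]
  simp only [add_zero, Finset.mul_sum, ← Finset.sum_add_distrib]
  exact Finset.sum_congr rfl fun i _ => by ring

/-! ## (b) Per-field facts: conservation law, Fisher square, row sum -/

/-- For a classical mean-zero `C² ∩ L²(μ_T)` left forward field `g` at coupling `γ > 0` (`L ≥ 2`), `v = ∂_{p_{L−1}} g`,
`E = ‖v‖²`: `v ∈ L²(μ_T)`; the differentiated conservation law `γ (v + (∂_{p_0} g) ∘ R) = p_{L−1}` (pointwise);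
`⟨v, p_{L−1}⟩ = 2γE`; and `γ ⟨g, p_0² − T⟩ = T² − 2γ²TE`. [folklore] -/
theorem field_facts (hω : 0 < ω₂) (hl : 0 < lam) (hβ : 0 < β) (hγ : 0 < γ) {T : ℝ} (hT : 0 < T) (hL : 2 ≤ L)
    {g : PhaseSpace L → ℝ} (hgC : ContDiff ℝ 2 g) (hgL2 : MemLp g 2 ((pinnedChain ω₂ lam β γ).gibbsMeasure L T))
    (hg0 : ∫ x, g x ∂((pinnedChain ω₂ lam β γ).gibbsMeasure L T) = 0)
    (hgeq : ∀ x, (pinnedChain ω₂ lam β γ).generator L T T g x = -(kin L 0 x - T)) :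
    MemLp (partialP (⟨L - 1, by omega⟩ : Fin L) g) 2 ((pinnedChain ω₂ lam β γ).gibbsMeasure L T) ∧
    (∀ x, γ * (partialP (⟨L - 1, by omega⟩ : Fin L) g x + partialP (⟨0, by omega⟩ : Fin L) g (siteReflection L x)) =
      x.2 ⟨L - 1, by omega⟩) ∧
    ∫ x, partialP (⟨L - 1, by omega⟩ : Fin L) g x * x.2 ⟨L - 1, by omega⟩ ∂((pinnedChain ω₂ lam β γ).gibbsMeasure L T)
      = 2 * γ * ∫ x, partialP (⟨L - 1, by omega⟩ : Fin L) g x ^ 2 ∂((pinnedChain ω₂ lam β γ).gibbsMeasure L T) ∧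
    γ * ∫ x, g x * (kin L 0 x - T) ∂((pinnedChain ω₂ lam β γ).gibbsMeasure L T) = T ^ 2 -
      2 * γ ^ 2 * T * ∫ x, partialP (⟨L - 1, by omega⟩ : Fin L) g x ^ 2 ∂((pinnedChain ω₂ lam β γ).gibbsMeasure L T) := by
  have hfis := stub_fisherSquare ω₂ lam β γ T hω hl hβ hγ hT L hL g hgC hgL2 hg0 hgeq
  have hrow := stub_rowSum ω₂ lam β γ T hω hl hβ hγ hT L hL g hgC hgL2 hg0 hgeq
  rw [eq_div_iff hγ.ne'] at hrow
  have hL0 : 0 < L := by omega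
  have hL1 : L - 1 < L := by omega
  set P := pinnedChain ω₂ lam β γ with hP
  set μ := P.gibbsMeasure L T with hμ
  set H := P.hamiltonian L with hH
  set B := OscillatorChain.bathWeight L with hB
  set i0 : Fin L := ⟨0, hL0⟩ with hi0
  set iR : Fin L := ⟨L - 1, hL1⟩ with hiR
  haveI : IsProbabilityMeasure μ := pinnedChain_isProbabilityMeasure_gibbsMeasure hω hl.le hβ.le γ L hT
  have hPγ : P.γ = γ := rfl
  have hV : ∀ r, P.V (-r) = P.V r := pinnedChain_V_neg ω₂ lam β γ
  have hR : MeasurePreserving (siteReflectionEquiv L) μ μ := measurePreserving_siteReflection_gibbsMeasure P hV L T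
  have hrevR : Fin.rev iR = i0 := Fin.ext (by simp only [Fin.val_rev, hiR, hi0]; omega)
  have hBnn : ∀ i, 0 ≤ B i := bathWeight_nonneg L
  have hBi0 : 0 < B i0 := by simp only [hB, OscillatorChain.bathWeight, hi0, if_true]; split_ifs <;> norm_num
  have hBiR : 0 < B iR := by simp only [hB, OscillatorChain.bathWeight, hiR, if_true]; split_ifs <;> norm_num
  have hgd : Differentiable ℝ g := hgC.differentiable two_ne_zero
  have hHs : ContDiff ℝ ∞ H :=
    P.contDiff_hamiltonian (pinnedChain_contDiff_U ω₂ lam β γ) (pinnedChain_contDiff_V ω₂ lam β γ) L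
  have hH0 : ∀ x, 0 ≤ H x := fun x => pinnedChain_hamiltonian_nonneg hω.le hl.le hβ.le γ L x
  have hHL2 : MemLp H 2 μ := SuperadditiveResistance.InsertionToolbox.pinnedChain_memLp_two_of_abs_le hω hl.le hβ.le
    γ L hT hHs.continuous (C := 1) (k := 1) fun x => by rw [abs_of_nonneg (hH0 x), pow_one, one_mul]; linarith [hH0 x]
  have hk0L2 : MemLp (fun x => kin L 0 x - T) 2 μ :=
    ((pinnedChain_memLp_two_snd_sq hω hl.le hβ.le γ L hT ⟨0, hL0⟩).sub (memLp_const T)).ae_eq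
      (ae_of_all _ fun x => by simp [kin_eq_sq hL0])
  have hpg : ∀ x, 1 * liouvilleOp P L g x + γ * bathOp L B T g x = -(kin L 0 x - T) := fun x => by
    rw [one_mul, ← hgeq x, generator_eq_liouvilleOp_add]; rfl
  have haL2 : MemLp (partialP iR g) 2 μ := memLp_partialP hω hl.le hβ.le γ L hT B hBnn 1 hγ hgC hgL2 hk0L2 hpg hBiR
  set gR : PhaseSpace L → ℝ := g ∘ siteReflection L with hgR
  have hgRC : ContDiff ℝ 2 gR := hgC.comp contDiff_siteReflection
  have hgRd : Differentiable ℝ gR := hgRC.differentiable two_ne_zero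
  have hgRL2 : MemLp gR 2 μ := hgL2.comp_measurePreserving hR
  have hgR0 : ∫ x, gR x ∂μ = 0 := by
    simpa only [siteReflectionEquiv_apply, hgR, Function.comp_apply, hg0] using
      hR.integral_comp' (f := siteReflectionEquiv L) g
  have hgReq : ∀ x, P.generator L T T gR x = -(kin L (L - 1) x - T) := fun x => by
    rw [hgR, P.generator_comp_siteReflection hV L T T g x, hgeq, kin_zero_siteReflection hL0]
  set cH : ℝ := ∫ x, H x ∂μ with hcH
  have hC1 : ContDiff ℝ 2 (fun y => γ * (g + gR) y) := contDiff_const.mul (hgC.add hgRC)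
  have hC2 : ContDiff ℝ 2 (fun y => (-1 : ℝ) * (H y - cH)) :=
    contDiff_const.mul ((hHs.of_le (by norm_cast)).sub contDiff_const)
  set u : PhaseSpace L → ℝ := (fun y => γ * (g + gR) y) + fun y => (-1 : ℝ) * (H y - cH) with hu
  have huC : ContDiff ℝ 2 u := hC1.add hC2
  have huL2 : MemLp u 2 μ := ((hgL2.add hgRL2).const_mul γ).add ((hHL2.sub (memLp_const cH)).const_mul (-1))
  have gen_add : ∀ {f₁ f₂ : PhaseSpace L → ℝ}, ContDiff ℝ 2 f₁ → ContDiff ℝ 2 f₂ → ∀ x,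
      P.generator L T T (f₁ + f₂) x = P.generator L T T f₁ x + P.generator L T T f₂ x := by
    intro f₁ f₂ h₁ h₂ x
    rw [generator_eq_liouvilleOp_add, generator_eq_liouvilleOp_add, generator_eq_liouvilleOp_add,
      liouvilleOp_add' P (h₁.differentiable two_ne_zero) (h₂.differentiable two_ne_zero), bathOp_add' h₁ h₂]
    ring
  have gen_const_mul : ∀ (a : ℝ) (f₁ : PhaseSpace L → ℝ) (x : PhaseSpace L),
      P.generator L T T (fun y => a * f₁ y) x = a * P.generator L T T f₁ x := by
    intro a f₁ x
    rw [generator_eq_liouvilleOp_add, generator_eq_liouvilleOp_add, liouvilleOp_const_mul, bathOp_const_mul]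
    ring
  have hu_gen : ∀ x, P.generator L T T u x = 0 := by
    intro x
    have e6 : P.generator L T T H x = -(γ * ((kin L 0 x - T) + (kin L (L - 1) x - T))) := by
      rw [generator_eq_liouvilleOp_add, liouvilleOp_hamiltonian, bathOp_bathWeight_hamiltonian P hL0, hPγ]
      ring
    rw [hu, gen_add hC1 hC2 x, gen_const_mul γ (g + gR) x, gen_add hgC hgRC x, gen_const_mul (-1) _ x,
      generator_sub_const P T T H cH x, e6, hgeq x, hgReq x]
    ring
  have hu_pde : ∀ x, 1 * liouvilleOp P L u x + γ * bathOp L B T u x = 0 := fun x => by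
    rw [one_mul, ← hu_gen x, generator_eq_liouvilleOp_add]; rfl
  have hgi : Integrable g μ := hgL2.integrable one_le_two
  have hgRi : Integrable gR μ := hgRL2.integrable one_le_two
  have hHi : Integrable H μ := hHL2.integrable one_le_two
  have hu_mean : ∫ x, u x ∂μ = 0 := by
    have i1 : Integrable (fun y => γ * (g y + gR y)) μ := (hgi.add hgRi).const_mul γ
    have i2 : Integrable (fun y => (-1 : ℝ) * (H y - cH)) μ := (hHi.sub (integrable_const cH)).const_mul (-1)
    simp only [hu, Pi.add_apply]
    rw [integral_add i1 i2, integral_const_mul, integral_const_mul, integral_add hgi hgRi,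
      integral_sub hHi (integrable_const cH), integral_const, hg0, hgR0]
    simp [hcH]
  have hu0 : ∀ x, u x = 0 := fun x =>
    eq_zero_of_liouville_pinnedChain hω hl.le hβ.le γ hL0 hT B hBnn hBi0 one_ne_zero hγ huC huL2 hu_pde hu_mean x
  have hfun : (fun y => γ * (g y + gR y)) = fun y => H y - cH := funext fun y => by
    have := hu0 y; simp only [hu, Pi.add_apply] at this; linarith
  have hgrad : ∀ x, γ * (partialP iR g x + partialP i0 g (siteReflection L x)) = x.2 iR := by
    intro x
    have e3 : partialP iR gR x = partialP i0 g (siteReflection L x) := by rw [hgR, partialP_comp_siteReflection, hrevR]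
    have e2 : partialP iR (fun y => g y + gR y) x = partialP iR g x + partialP iR gR x := partialP_add hgd hgRd iR x
    have key : partialP iR (fun y => γ * (g y + gR y)) x = partialP iR (fun y => H y - cH) x := by rw [hfun]
    rwa [partialP_const_mul γ _ iR x, e2, e3, partialP_sub_const', P.partialP_hamiltonian] at key
  have hBf : ∫ x, g x * (kin L (L - 1) x - T) ∂μ = T * ∫ x, partialP iR g x * x.2 iR ∂μ := by
    rw [← integral_mul_sq_sub_gibbsMeasure hω hl.le hβ.le γ L hT iR hgd hgL2 haL2]
    exact integral_congr_ae (ae_of_all _ fun x => by dsimp only; rw [kin_eq_sq hL1])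
  exact ⟨haL2, hgrad, mul_left_cancel₀ hT.ne' (by linear_combination hfis - hBf), by linear_combination hrow - γ * hfis⟩

end Cross

/-! ## The registered helper -/

/-- **Coupling transfer of the far-contact Dirichlet energy** (registered helper of line `far-contact-fisher-square`):
for `0 < γ₁ ≤ γ₂` and the left forward fields `g₁, g₂` at couplings `γ₁, γ₂` (same `T`, `L ≥ 2`), `γ₂² E₂ ≤ γ₁² E₁` and
`γ₁⁴ E₁ ≤ γ₂⁴ E₂`, `E_i = ‖∂_{p_{L−1}} g_i‖²_{L²(μ_T)}`: `γ²E(γ)` is non-increasing, `γ⁴E(γ)` non-decreasing. [folklore] -/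
theorem helper_couplingTransfer_farGradient :
    ∀ (ω₂ lam β γ₁ γ₂ T : ℝ), 0 < ω₂ → 0 < lam → 0 < β → 0 < γ₁ → γ₁ ≤ γ₂ → 0 < T →
      ∀ (L : ℕ) (hL : 2 ≤ L) (g₁ g₂ : PhaseSpace L → ℝ),
        ContDiff ℝ 2 g₁ → MemLp g₁ 2 ((pinnedChain ω₂ lam β γ₁).gibbsMeasure L T) →
        ∫ x, g₁ x ∂((pinnedChain ω₂ lam β γ₁).gibbsMeasure L T) = 0 →
        (∀ x, (pinnedChain ω₂ lam β γ₁).generator L T T g₁ x = -(kin L 0 x - T)) →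
        ContDiff ℝ 2 g₂ → MemLp g₂ 2 ((pinnedChain ω₂ lam β γ₂).gibbsMeasure L T) →
        ∫ x, g₂ x ∂((pinnedChain ω₂ lam β γ₂).gibbsMeasure L T) = 0 →
        (∀ x, (pinnedChain ω₂ lam β γ₂).generator L T T g₂ x = -(kin L 0 x - T)) →
        γ₂ ^ 2 * ∫ x, (partialP (⟨L - 1, by omega⟩ : Fin L) g₂ x) ^ 2 ∂((pinnedChain ω₂ lam β γ₂).gibbsMeasure L T) ≤
            γ₁ ^ 2 * ∫ x, (partialP (⟨L - 1, by omega⟩ : Fin L) g₁ x) ^ 2 ∂((pinnedChain ω₂ lam β γ₁).gibbsMeasure L T) ∧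
          γ₁ ^ 4 * ∫ x, (partialP (⟨L - 1, by omega⟩ : Fin L) g₁ x) ^ 2 ∂((pinnedChain ω₂ lam β γ₁).gibbsMeasure L T) ≤
            γ₂ ^ 4 * ∫ x, (partialP (⟨L - 1, by omega⟩ : Fin L) g₂ x) ^ 2 ∂((pinnedChain ω₂ lam β γ₂).gibbsMeasure L T) := by
  intro ω₂ lam β γ₁ γ₂ T hω hl hβ hγ₁ h12 hT L hL g₁ g₂ hg₁C hg₁L2 hg₁0 hg₁eq hg₂C hg₂L2 hg₂0 hg₂eq
  have hγ₂ : 0 < γ₂ := hγ₁.trans_le h12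
  obtain ⟨hv₁, hgrad₁, hpv₁, hA₁⟩ := field_facts hω hl hβ hγ₁ hT hL hg₁C hg₁L2 hg₁0 hg₁eq
  obtain ⟨hv₂, hgrad₂, hpv₂, hA₂⟩ := field_facts hω hl hβ hγ₂ hT hL hg₂C hg₂L2 hg₂0 hg₂eq
  have hL0 : 0 < L := by omega
  have hL1 : L - 1 < L := by omega
  rw [show (pinnedChain ω₂ lam β γ₂).gibbsMeasure L T = (pinnedChain ω₂ lam β γ₁).gibbsMeasure L T from rfl]
    at hg₂L2 hv₂ hpv₂ hA₂ ⊢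
  set P := pinnedChain ω₂ lam β γ₁ with hP
  set μ := P.gibbsMeasure L T with hμ
  set B := OscillatorChain.bathWeight L with hB
  set i0 : Fin L := ⟨0, hL0⟩ with hi0
  set iR : Fin L := ⟨L - 1, hL1⟩ with hiR
  haveI : IsProbabilityMeasure μ := pinnedChain_isProbabilityMeasure_gibbsMeasure hω hl.le hβ.le γ₁ L hT
  have hR : MeasurePreserving (siteReflectionEquiv L) μ μ :=
    measurePreserving_siteReflection_gibbsMeasure P (pinnedChain_V_neg ω₂ lam β γ₁) L T
  have hBnn : ∀ i, 0 ≤ B i := bathWeight_nonneg L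
  have hk0L2 : MemLp (fun x => kin L 0 x - T) 2 μ :=
    ((pinnedChain_memLp_two_snd_sq hω hl.le hβ.le γ₁ L hT ⟨0, hL0⟩).sub (memLp_const T)).ae_eq
      (ae_of_all _ fun x => by simp [kin_eq_sq hL0])
  have hpg₁ : ∀ x, 1 * liouvilleOp P L g₁ x + γ₁ * bathOp L B T g₁ x = -(kin L 0 x - T) := fun x => by
    rw [one_mul, ← hg₁eq x, generator_eq_liouvilleOp_add]; rfl
  have hpg₂ : ∀ x, 1 * liouvilleOp P L g₂ x + γ₂ * bathOp L B T g₂ x = -(kin L 0 x - T) := fun x => by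
    rw [one_mul, ← hg₂eq x, generator_eq_liouvilleOp_add]; rfl
  have hX := polar_two hω hl.le hβ.le L hT B hBnn 1 hγ₁ hγ₂ hg₁C hg₂C hg₁L2 hg₂L2 hk0L2 hk0L2 hpg₁ hpg₂
  rw [sum_bathWeight_mul' (fun i => ∫ x, partialP i g₁ x * partialP i g₂ x * P.gibbsDensity L T x)
    (b₀ := i0) (b₁ := iR) rfl rfl] at hX
  have hXμ : (∫ x, g₂ x * (kin L 0 x - T) ∂μ) + ∫ x, g₁ x * (kin L 0 x - T) ∂μ = (γ₁ + γ₂) * T *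
      ((∫ x, partialP i0 g₁ x * partialP i0 g₂ x ∂μ) + ∫ x, partialP iR g₁ x * partialP iR g₂ x ∂μ) := by
    rw [P.integral_gibbsMeasure, P.integral_gibbsMeasure, P.integral_gibbsMeasure, P.integral_gibbsMeasure]
    linear_combination (∫ x, P.gibbsDensity L T x)⁻¹ * hX
  have hbb : ∫ x, partialP i0 g₁ (siteReflection L x) * partialP i0 g₂ (siteReflection L x) ∂μ =
      ∫ x, partialP i0 g₁ x * partialP i0 g₂ x ∂μ := by
    simpa only [siteReflectionEquiv_apply] using
      hR.integral_comp' (f := siteReflectionEquiv L) (fun y => partialP i0 g₁ y * partialP i0 g₂ y)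
  have hpL2 : MemLp (fun x : PhaseSpace L => x.2 iR) 2 μ := pinnedChain_memLp_two_snd hω hl.le hβ.le γ₁ L hT iR
  have ipp : Integrable (fun x : PhaseSpace L => x.2 iR ^ 2) μ := hpL2.integrable_sq
  have ipv₁ : Integrable (fun x => partialP iR g₁ x * x.2 iR) μ := hv₁.integrable_mul hpL2
  have ipv₂ : Integrable (fun x => partialP iR g₂ x * x.2 iR) μ := hv₂.integrable_mul hpL2
  have ivv : Integrable (fun x => partialP iR g₁ x * partialP iR g₂ x) μ := hv₁.integrable_mul hv₂
  have hp2 : ∫ x, x.2 iR ^ 2 ∂μ = T := pinnedChain_integral_snd_sq hω hl.le hβ.le γ₁ L hT iR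
  have hexp : γ₁ * γ₂ * ∫ x, partialP i0 g₁ (siteReflection L x) * partialP i0 g₂ (siteReflection L x) ∂μ =
      T - γ₂ * (2 * γ₂ * ∫ x, partialP iR g₂ x ^ 2 ∂μ) - γ₁ * (2 * γ₁ * ∫ x, partialP iR g₁ x ^ 2 ∂μ) +
        γ₁ * γ₂ * ∫ x, partialP iR g₁ x * partialP iR g₂ x ∂μ := by
    have i12 : Integrable (fun x => x.2 iR ^ 2 - γ₂ * (partialP iR g₂ x * x.2 iR)) μ := ipp.sub (ipv₂.const_mul γ₂)
    have i123 : Integrable (fun x => x.2 iR ^ 2 - γ₂ * (partialP iR g₂ x * x.2 iR) -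
        γ₁ * (partialP iR g₁ x * x.2 iR)) μ := i12.sub (ipv₁.const_mul γ₁)
    rw [← hp2, ← hpv₁, ← hpv₂, ← integral_const_mul, ← integral_const_mul γ₂, ← integral_const_mul γ₁,
      ← integral_const_mul (γ₁ * γ₂), ← integral_sub ipp (ipv₂.const_mul γ₂), ← integral_sub i12 (ipv₁.const_mul γ₁),
      ← integral_add i123 (ivv.const_mul (γ₁ * γ₂))]
    refine integral_congr_ae (ae_of_all _ fun x => ?_)
    have e₁ : γ₁ * partialP i0 g₁ (siteReflection L x) = x.2 iR - γ₁ * partialP iR g₁ x := by linarith [hgrad₁ x]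
    have e₂ : γ₂ * partialP i0 g₂ (siteReflection L x) = x.2 iR - γ₂ * partialP iR g₂ x := by linarith [hgrad₂ x]
    dsimp only
    linear_combination (x.2 iR - γ₂ * partialP iR g₂ x) * e₁ + γ₁ * partialP i0 g₁ (siteReflection L x) * e₂
  have hVid : (∫ x, partialP iR g₁ x * partialP iR g₂ x ∂μ) * (γ₁ * γ₂ * (γ₁ + γ₂)) =
      γ₁ ^ 3 * (∫ x, partialP iR g₁ x ^ 2 ∂μ) + γ₂ ^ 3 * ∫ x, partialP iR g₂ x ^ 2 ∂μ := by
    apply mul_left_cancel₀ (mul_ne_zero two_ne_zero hT.ne')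
    linear_combination γ₂ * hA₁ + γ₁ * hA₂ - (γ₁ + γ₂) * T * hexp + (γ₁ + γ₂) * T * (γ₁ * γ₂) * hbb -
      γ₁ * γ₂ * hXμ
  have i1 : Integrable (fun x => partialP iR g₁ x ^ 2) μ := hv₁.integrable_sq
  have i2 : Integrable (fun x => partialP iR g₂ x ^ 2) μ := hv₂.integrable_sq
  have hCS : ∀ t : ℝ, 2 * t * (∫ x, partialP iR g₁ x * partialP iR g₂ x ∂μ) ≤
      (∫ x, partialP iR g₁ x ^ 2 ∂μ) + t ^ 2 * ∫ x, partialP iR g₂ x ^ 2 ∂μ := fun t => by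
    have h0 : 0 ≤ ∫ x, (partialP iR g₁ x - t * partialP iR g₂ x) ^ 2 ∂μ := integral_nonneg fun x => sq_nonneg _
    have i3 : Integrable (fun x => partialP iR g₁ x ^ 2 - 2 * t * (partialP iR g₁ x * partialP iR g₂ x)) μ :=
      i1.sub (ivv.const_mul _)
    have he : ∫ x, (partialP iR g₁ x - t * partialP iR g₂ x) ^ 2 ∂μ = (∫ x, partialP iR g₁ x ^ 2 ∂μ) -
        2 * t * (∫ x, partialP iR g₁ x * partialP iR g₂ x ∂μ) + t ^ 2 * ∫ x, partialP iR g₂ x ^ 2 ∂μ := by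
      rw [← integral_const_mul, ← integral_const_mul, ← integral_sub i1 (ivv.const_mul _), ← integral_add i3 (i2.const_mul _)]
      exact integral_congr_ae (ae_of_all _ fun x => by ring)
    linarith
  exact couplingTransfer_real hγ₁ h12 (integral_nonneg fun x => sq_nonneg _) (integral_nonneg fun x => sq_nonneg _) hVid hCS

end Summit.AtomisticToContinuum.FouriersLaw.Cruxes.ConductanceLowerBound.ForecastSensitivity

end
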